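import Literature.NumberTheory.Automorphic.TateLocalZetaShells
import Mathlib.MeasureTheory.Integral.Bochner.Set
import HarnessLib

/-!
# Haar measure on a non-archimedean local field: balls, shells, scaling, the multiplicative measure

Topic `NumberTheory/Automorphic`; theorems only (no definition, no named fact, no instance), in the
sub-namespace `Literature.NumberTheory.Automorphic.LocalFieldHaar`, on top of `TateLocalZetaShells`
(topology of the balls `𝔭^m = primePowBall F m`, regularity of Haar measures, Tate's Lemma 2.2.5
`μ(a • s) = ‖a‖ μ(s)` and the substitution rule). Elementary measure theory of a non-archimedean
local field `F` (Mathlib `IsNonarchimedeanLocalField`, Borel structure, `μ` an additive Haar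
measure) INSIDE `F` — the route to Tate's local functional equation in which `d^×x` is the
explicit measure `‖x‖⁻¹ dx` and all zeta integrals are additive integrals over `F`
(Tate 1950, §2.2–2.5; Weil, *Basic Number Theory*, Ch. I §2, Ch. II §1; Bushnell–Henniart 2006,
§1.1, §23):

* the shells `𝔭^m ∖ 𝔭^{m+1} = {‖x‖ = q^{-m}}` (inside `F`, not `Fˣ`), **the index formula**
  `μ(𝔭^m) = q · μ(𝔭^{m+1})` for every `m ∈ ℤ` (the `q = #𝓀_F` cosets of `𝔭^{m+1}` in `𝔭^m`),
  hence `μ(𝔭^m) = q^{-m} μ(𝒪)`, the measure of the shells, `μ{0} = 0`; continuity of `‖·‖_F`;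
* the shell decomposition of integrals over `𝔭^n ∖ {0}` of functions bounded by `C θ^i` on the
  `i`-th shell, `θ < q` (absolute convergence of Tate's zeta integrals, shell by shell);
* **the multiplicative Haar measure** `d^×x = ‖x‖⁻¹ dx`: the pull-back to `Fˣ` of
  `μ.withDensity ‖·‖⁻¹` is a Haar measure on `Fˣ`, and Tate's zeta integral against it is the
  additive integral `∫ f(x) χ(x) ‖x‖^{s-1} dμ(x)`.

## References

* J. Tate, *Fourier analysis in number fields and Hecke's zeta-functions* (1950), §2.2–2.5.
* A. Weil, *Basic Number Theory* (1967), Ch. I §2 (module), Ch. II §1.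
* C. J. Bushnell, G. Henniart, *The local Langlands conjecture for GL(2)* (2006), §1.1, §23.
-/

set_option autoImplicit false

noncomputable section

open MeasureTheory ValuativeRel Filter Topology Set
open scoped NNReal ENNReal Pointwise
open Literature.NumberTheory.GaloisRepresentations.IsNonarchimedeanLocalField
open Literature.NumberTheory.GaloisRepresentations (modulus)

namespace Literature.NumberTheory.Automorphic

namespace LocalFieldHaar

variable {F : Type*} [Field F] [ValuativeRel F] [TopologicalSpace F] [IsNonarchimedeanLocalField F]

/-! ### Balls and shells: algebra

The topology of the balls (`isCompact_primePowBall`, `isOpen_primePowBall`,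
`measurableSet_primePowBall`, `regular_of_isAddHaarMeasure`, …) is in `TateLocalZetaShells`. -/

/-- `q⁻¹`-bookkeeping: `(q⁻¹)^(m+1) < (q⁻¹)^m`. [folklore] -/
theorem inv_zpow_succ_lt (m : ℤ) :
    ((residueFieldCard F : ℝ≥0)⁻¹) ^ (m + 1) < ((residueFieldCard F : ℝ≥0)⁻¹) ^ m := by
  rw [zpow_add_one₀ inv_residueFieldCard_pos.ne']
  exact mul_lt_of_lt_one_right (zpow_pos inv_residueFieldCard_pos m) inv_residueFieldCard_lt_one

/-- **Discreteness of `‖·‖_F`**: `‖x‖_F < (q⁻¹)^m ↔ ‖x‖_F ≤ (q⁻¹)^(m+1)`. [folklore] -/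
theorem normAbs_lt_zpow_iff {x : F} {m : ℤ} :
    normAbs F x < ((residueFieldCard F : ℝ≥0)⁻¹) ^ m ↔
      normAbs F x ≤ ((residueFieldCard F : ℝ≥0)⁻¹) ^ (m + 1) := by
  refine ⟨fun h => ?_, fun h => h.trans_lt (inv_zpow_succ_lt m)⟩
  by_cases hx : x = 0
  · rw [hx, map_zero]; exact bot_le
  obtain ⟨k, hk⟩ := exists_normAbs_eq_inv_zpow hx
  rw [hk] at h ⊢
  have hlt := (zpow_lt_zpow_iff_right_of_lt_one₀ inv_residueFieldCard_pos
    inv_residueFieldCard_lt_one).1 h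
  exact zpow_le_zpow_right_of_le_one₀ inv_residueFieldCard_pos inv_residueFieldCard_lt_one.le
    (by omega)

/-- `x ∉ 𝔭^{m+1} ↔ (q⁻¹)^m ≤ ‖x‖`… in the form: `x ∈ 𝔭^m ∖ 𝔭^{m+1} ↔ ‖x‖_F = (q⁻¹)^m`
(**the shells are the spheres**). [folklore] -/
theorem mem_shell_iff {x : F} {m : ℤ} :
    x ∈ primePowBall F m \ primePowBall F (m + 1) ↔
      normAbs F x = ((residueFieldCard F : ℝ≥0)⁻¹) ^ m := by
  rw [Set.mem_sdiff, mem_primePowBall_iff, mem_primePowBall_iff, ← normAbs_lt_zpow_iff, not_lt,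
    le_antisymm_iff]

/-- Elements of a shell are non-zero. [folklore] -/
theorem ne_zero_of_mem_shell {x : F} {m : ℤ} (hx : x ∈ primePowBall F m \ primePowBall F (m + 1)) :
    x ≠ 0 := by
  rintro rfl
  rw [mem_shell_iff, map_zero] at hx
  exact (zpow_pos inv_residueFieldCard_pos m).ne hx

/-- `𝔭^0 = 𝒪_F`. [folklore] -/
theorem mem_primePowBall_zero_iff {x : F} : x ∈ primePowBall F 0 ↔ x ∈ 𝒪[F] := by
  rw [mem_primePowBall_iff, zpow_zero, normAbs_le_one_iff]

/-- `𝔭^1 = 𝔪_F = {v < 1}`. [folklore] -/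
theorem mem_primePowBall_one_iff {x : F} : x ∈ primePowBall F 1 ↔ valuation F x < 1 := by
  rw [mem_primePowBall_iff, ← zero_add (1 : ℤ), ← normAbs_lt_zpow_iff, zpow_zero, normAbs_lt_one_iff]

/-- **Dilation of balls**: `a • 𝔭^m = 𝔭^{m+k}` for `‖a‖_F = (q⁻¹)^k`. [folklore] -/
theorem smul_primePowBall {a : F} {k : ℤ} (ha : normAbs F a = ((residueFieldCard F : ℝ≥0)⁻¹) ^ k)
    (m : ℤ) : a • primePowBall F m = primePowBall F (m + k) := by
  have ha0 : a ≠ 0 := by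
    rintro rfl
    rw [map_zero] at ha
    exact (zpow_pos inv_residueFieldCard_pos k).ne ha
  ext x
  rw [Set.mem_smul_set_iff_inv_smul_mem₀ ha0, smul_eq_mul, mul_mem_primePowBall_iff
    (k := -k) (by rw [map_inv₀, ha, ← zpow_neg]), sub_neg_eq_add]

/-- The translate `a + 𝔭^m` of a ball lies in the shell of `a` when `a ∉ 𝔭^m`:
`‖a + t‖ = ‖a‖` for `‖t‖ ≤ (q⁻¹)^m < ‖a‖`. [folklore] -/
theorem normAbs_add_eq_of_lt {a t : F} (h : normAbs F t < normAbs F a) : normAbs F (a + t) = normAbs F a := by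
  rw [normAbs_lt_normAbs_iff] at h
  have := Valuation.map_add_eq_of_lt_left (valuation F) h
  rw [normAbs_apply, normAbs_apply, this]

/-! ### Balls: Haar measure, the index formula -/

section Measure

variable [MeasurableSpace F] [BorelSpace F] (μ : Measure F) [μ.IsAddHaarMeasure]

/-- **The index formula** `μ(𝔭^m) = q · μ(𝔭^{m+1})`: `𝔭^m` is the disjoint union of the
`q = #𝓀_F` translates `a s(κ) + 𝔭^{m+1}`, `κ ∈ 𝓀_F`, where `‖a‖ = (q⁻¹)^m` and `s` is a section of
the residue map (Weil 1967, Ch. I §4; Bushnell–Henniart 2006, §1.1). [folklore] -/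
theorem measure_primePowBall_eq_mul_succ (m : ℤ) :
    μ (primePowBall F m) = (residueFieldCard F : ℝ≥0∞) * μ (primePowBall F (m + 1)) := by
  classical
  obtain ⟨a, ha0, ha⟩ := exists_normAbs_eq_inv_zpow_of_int (F := F) m
  -- a section of the residue map
  have hsurj : Function.Surjective (IsLocalRing.residue 𝒪[F]) := Ideal.Quotient.mk_surjective
  set s : 𝓀[F] → 𝒪[F] := fun κ => (hsurj κ).choose with hs_def
  have hs : ∀ κ, IsLocalRing.residue 𝒪[F] (s κ) = κ := fun κ => (hsurj κ).choose_spec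
  haveI : Fintype 𝓀[F] := Fintype.ofFinite _
  -- the pieces
  set P : 𝓀[F] → Set F := fun κ => (a * (s κ : F)) +ᵥ primePowBall F (m + 1) with hP
  have hPmeas : ∀ κ, MeasurableSet (P κ) := fun κ =>
    (measurableSet_primePowBall (m + 1)).const_vadd _
  have hPμ : ∀ κ, μ (P κ) = μ (primePowBall F (m + 1)) := fun κ => measure_vadd _ _ _
  -- membership in a piece
  have hmemP : ∀ (κ : 𝓀[F]) (x : F), x ∈ P κ ↔ x - a * (s κ : F) ∈ primePowBall F (m + 1) := by
    intro κ x
    rw [hP, Set.mem_vadd_set_iff_neg_vadd_mem, vadd_eq_add, neg_add_eq_sub]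
  have hball1 : ∀ y : F, a * y ∈ primePowBall F (m + 1) ↔ valuation F y < 1 := by
    intro y
    rw [mul_mem_primePowBall_iff ha, add_sub_cancel_left, mem_primePowBall_one_iff]
  -- cover
  have hcover : primePowBall F m = ⋃ κ, P κ := by
    ext x
    simp only [Set.mem_iUnion]
    constructor
    · intro hx
      have hx' : a⁻¹ * x ∈ 𝒪[F] := by
        have h1 : a * (a⁻¹ * x) ∈ primePowBall F m := by rwa [mul_inv_cancel_left₀ ha0]
        have h2 := (mul_mem_primePowBall_iff ha).1 h1
        rwa [sub_self, mem_primePowBall_zero_iff] at h2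
      refine ⟨IsLocalRing.residue 𝒪[F] ⟨a⁻¹ * x, hx'⟩, ?_⟩
      rw [hmemP]
      have : x - a * (s (IsLocalRing.residue 𝒪[F] ⟨a⁻¹ * x, hx'⟩) : F) =
          a * (a⁻¹ * x - (s (IsLocalRing.residue 𝒪[F] ⟨a⁻¹ * x, hx'⟩) : F)) := by
        rw [mul_sub, mul_inv_cancel_left₀ ha0]
      rw [this, hball1]
      have h2 := (DeltaCharBorel.residue_eq_residue_iff ⟨a⁻¹ * x, hx'⟩
        (s (IsLocalRing.residue 𝒪[F] ⟨a⁻¹ * x, hx'⟩))).1 (hs _).symm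
      exact h2
    · rintro ⟨κ, hκ⟩
      rw [hmemP] at hκ
      have : x = a * (s κ : F) + (x - a * (s κ : F)) := by ring
      rw [this]
      refine add_mem_primePowBall ?_ (primePowBall_antitone (by omega) hκ)
      rw [mul_mem_primePowBall_iff ha, sub_self, mem_primePowBall_zero_iff]
      exact (s κ).2
  -- disjoint
  have hdisj : Pairwise (Function.onFun Disjoint P) := by
    intro κ κ' hne
    rw [Function.onFun, Set.disjoint_left]
    intro x hx hx'
    rw [hmemP] at hx hx'
    apply hne
    rw [← hs κ, ← hs κ']
    rw [DeltaCharBorel.residue_eq_residue_iff, ← hball1, mul_sub]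
    have : a * (s κ : F) - a * (s κ' : F) = (x - a * (s κ' : F)) - (x - a * (s κ : F)) := by ring
    rw [this, sub_eq_add_neg]
    exact add_mem_primePowBall hx' (neg_mem_primePowBall hx)
  rw [hcover, measure_iUnion hdisj hPmeas, tsum_fintype]
  simp only [hPμ, Finset.sum_const, Finset.card_univ, nsmul_eq_mul]
  rw [residueFieldCard, Nat.card_eq_fintype_card]

/-- **`μ(𝔭^m) = (q⁻¹)^m μ(𝒪)`** (iterate the index formula in both directions). [folklore] -/
theorem measureReal_primePowBall (m : ℤ) :
    μ.real (primePowBall F m) = ((residueFieldCard F : ℝ)⁻¹) ^ m * μ.real (primePowBall F 0) := by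
  have hq : (residueFieldCard F : ℝ) ≠ 0 := Nat.cast_ne_zero.2 (residueFieldCard_ne_zero F)
  -- real form of the index formula
  have step : ∀ k : ℤ, μ.real (primePowBall F k) = residueFieldCard F * μ.real (primePowBall F (k + 1)) := by
    intro k
    rw [measureReal_def, measureReal_def, measure_primePowBall_eq_mul_succ μ k, ENNReal.toReal_mul]
    simp
  -- induction on `m` from `0`
  induction m using Int.induction_on with
  | zero => simp
  | succ n ih =>
    have h := step (n : ℤ)
    rw [ih] at h
    have h2 : μ.real (primePowBall F ((n : ℤ) + 1)) =
        (residueFieldCard F : ℝ)⁻¹ * (((residueFieldCard F : ℝ)⁻¹) ^ (n : ℤ) *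
          μ.real (primePowBall F 0)) := by
      rw [h, ← mul_assoc, inv_mul_cancel₀ hq, one_mul]
    rw [h2, zpow_add_one₀ (inv_ne_zero hq)]
    ring
  | pred n ih =>
    rw [step (-(n : ℤ) - 1), sub_add_cancel, ih, zpow_sub_one₀ (inv_ne_zero hq), inv_inv]
    ring

omit [BorelSpace F] in
/-- `0 < μ(𝔭^m)` as a real number. [folklore] -/
theorem measureReal_primePowBall_pos (m : ℤ) : 0 < μ.real (primePowBall F m) :=
  ENNReal.toReal_pos (addHaar_primePowBall_pos μ m).ne' (measure_primePowBall_lt_top μ m).ne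

/-- **Measure of a shell**: `μ(𝔭^m ∖ 𝔭^{m+1}) = (q⁻¹)^m (1 - q⁻¹) μ(𝒪)`. [folklore] -/
theorem measureReal_shell (m : ℤ) :
    μ.real (primePowBall F m \ primePowBall F (m + 1)) =
      ((residueFieldCard F : ℝ)⁻¹) ^ m * (1 - (residueFieldCard F : ℝ)⁻¹) *
        μ.real (primePowBall F 0) := by
  have hq : (residueFieldCard F : ℝ) ≠ 0 := Nat.cast_ne_zero.2 (residueFieldCard_ne_zero F)
  rw [measureReal_sdiff (primePowBall_antitone (by omega)) (measurableSet_primePowBall _)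
    (measure_primePowBall_lt_top μ _).ne, measureReal_primePowBall μ m,
    measureReal_primePowBall μ (m + 1), zpow_add_one₀ (inv_ne_zero hq)]
  ring

/-- **Points are null**: `μ {0} = 0` (`{0} ⊆ 𝔭^m` for all `m` and `μ(𝔭^m) → 0`). [folklore] -/
theorem measure_singleton_zero : μ ({0} : Set F) = 0 := by
  haveI : T2Space F := (GaloisRepresentations.IsNonarchimedeanLocalField.isLocalField F).toT2Space
  haveI := regular_of_isAddHaarMeasure μ
  exact GaloisRepresentations.measure_singleton_zero_eq_zero
    (GaloisRepresentations.IsNonarchimedeanLocalField.isLocalField F).not_discrete μ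

/-! ### Scaling of Haar measure (`TateLocalZetaShells`: `addHaar_smul_set`, `map_mul_left_addHaar`,
`integral_comp_mul_left`) — two corollaries -/

/-- `∫ g(u x) dμ(x) = ∫ g dμ` for `‖u‖_F = 1`. [folklore] -/
theorem integral_comp_mul_left_of_normAbs_eq_one {E : Type*} [NormedAddCommGroup E]
    [NormedSpace ℝ E] (g : F → E) {u : F} (hu : normAbs F u = 1) :
    ∫ x, g (u * x) ∂μ = ∫ x, g x ∂μ := by
  have hu0 : u ≠ 0 := by
    rintro rfl
    rw [map_zero] at hu
    exact zero_ne_one hu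
  rw [integral_comp_mul_left μ hu0 g, map_inv₀, hu, inv_one, NNReal.coe_one, one_smul]

/-- Change of variables for the lower integral: `∫⁻ g(a x) dμ(x) = ‖a‖⁻¹ ∫⁻ g dμ`. [folklore] -/
theorem lintegral_comp_mul_left (g : F → ℝ≥0∞) {a : F} (ha : a ≠ 0) :
    ∫⁻ x, g (a * x) ∂μ = ((normAbs F a)⁻¹ : ℝ≥0) * ∫⁻ x, g x ∂μ := by
  calc ∫⁻ x, g (a * x) ∂μ = ∫⁻ y, g y ∂(μ.map (MeasurableEquiv.mulLeft₀ a ha)) :=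
        (lintegral_map_equiv g (MeasurableEquiv.mulLeft₀ a ha)).symm
    _ = ∫⁻ y, g y ∂(((normAbs F a⁻¹ : ℝ≥0) : ℝ≥0∞) • μ) := by
        rw [MeasurableEquiv.coe_mulLeft₀, map_mul_left_addHaar μ ha]
    _ = ((normAbs F a)⁻¹ : ℝ≥0) * ∫⁻ x, g x ∂μ := by
        simp only [lintegral_smul_measure, smul_eq_mul, map_inv₀]

/-! ### Continuity of `‖·‖_F` -/

omit [MeasurableSpace F] [BorelSpace F] in
/-- **`‖·‖_F` is continuous** (locally constant off `0`; `‖x‖ → 0` as `x → 0`). [folklore] -/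
theorem continuous_normAbs : Continuous (normAbs F) := by
  rw [continuous_iff_continuousAt]
  intro x
  by_cases hx : x = 0
  · subst hx
    rw [ContinuousAt, map_zero, hasBasis_nhds_zero_primePowBall.tendsto_iff NNReal.nhds_zero_basis]
    intro ε hε
    obtain ⟨n, hn⟩ := exists_pow_lt_of_lt_one hε (inv_residueFieldCard_lt_one (F := F))
    refine ⟨n, trivial, fun y hy => ?_⟩
    rw [Set.mem_Iio]
    refine lt_of_le_of_lt hy ?_
    rwa [zpow_natCast]
  · have hvx : valuation F x ≠ 0 := (map_ne_zero _).2 hx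
    have h : ∀ᶠ y in 𝓝 x, normAbs F x = normAbs F y := by
      filter_upwards [(DeltaCharBorel.isOpen_setOf_valuation_eq hvx).mem_nhds rfl] with y hy
      rw [normAbs_apply, normAbs_apply, (hy : valuation F y = valuation F x)]
    exact tendsto_const_nhds.congr' h

/-- `‖·‖_F` is measurable. [folklore] -/
theorem measurable_normAbs : Measurable (normAbs F) :=
  continuous_normAbs.measurable

/-! ### Shells and the shell decomposition of integrals -/

omit [MeasurableSpace F] [BorelSpace F] in
/-- Shells with different indices are disjoint. [folklore] -/
theorem disjoint_shell {j j' : ℤ} (h : j ≠ j') :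
    Disjoint (primePowBall F j \ primePowBall F (j + 1)) (primePowBall F j' \ primePowBall F (j' + 1)) := by
  rw [Set.disjoint_left]
  intro x hx hx'
  rw [mem_shell_iff] at hx hx'
  exact h (zpow_right_injective₀ inv_residueFieldCard_pos inv_residueFieldCard_lt_one.ne (hx.symm.trans hx'))

/-- Shells are measurable. [folklore] -/
theorem measurableSet_shell (j : ℤ) : MeasurableSet (primePowBall F j \ primePowBall F (j + 1)) :=
  (measurableSet_primePowBall j).diff (measurableSet_primePowBall _)

omit [MeasurableSpace F] [BorelSpace F] in
/-- **`𝔭^n ∖ {0}` is the union of the shells `𝔭^{n+i} ∖ 𝔭^{n+i+1}`, `i ∈ ℕ`.** [folklore] -/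
theorem iUnion_shell (n : ℤ) :
    (⋃ i : ℕ, primePowBall F (n + i) \ primePowBall F (n + i + 1)) = primePowBall F n \ {0} := by
  ext x
  simp only [Set.mem_iUnion, Set.mem_sdiff, Set.mem_singleton_iff]
  constructor
  · rintro ⟨i, hi⟩
    exact ⟨primePowBall_antitone (by omega) hi.1, ne_zero_of_mem_shell hi⟩
  · rintro ⟨hx, hx0⟩
    obtain ⟨k, hk⟩ := exists_normAbs_eq_inv_zpow hx0
    have hnk : n ≤ k := by
      rw [mem_primePowBall_iff, hk] at hx
      exact (zpow_le_zpow_iff_right_of_lt_one₀ inv_residueFieldCard_pos inv_residueFieldCard_lt_one).1 hx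
    refine ⟨(k - n).toNat, ?_⟩
    rw [← Set.mem_sdiff, mem_shell_iff, hk, Int.toNat_of_nonneg (by omega), add_sub_cancel]

/-- **Shell decomposition with absolute convergence.** If `g` is a.e.-strongly measurable and
`‖g x‖ ≤ C θ^i` on the shell `𝔭^{n+i} ∖ 𝔭^{n+i+1}` with `0 ≤ θ < q` (the shells have measure
`∝ q^{-i}`), then `g` is integrable on `𝔭^n ∖ {0}` and its integral is the sum of the shell
integrals (Tate 1950, §2.4: absolute convergence of the local zeta integrals, shell by shell).
[folklore] -/
theorem integrableOn_and_hasSum_shell (g : F → ℂ) (hg : AEStronglyMeasurable g μ) (n : ℤ)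
    {C θ : ℝ} (hC : 0 ≤ C) (hθ0 : 0 ≤ θ) (hθ : θ < residueFieldCard F)
    (hM : ∀ (i : ℕ), ∀ x ∈ primePowBall F (n + i) \ primePowBall F (n + i + 1), ‖g x‖ ≤ C * θ ^ i) :
    IntegrableOn g (primePowBall F n \ {0}) μ ∧
    HasSum (fun i : ℕ => ∫ x in primePowBall F (n + i) \ primePowBall F (n + i + 1), g x ∂μ)
      (∫ x in primePowBall F n \ {0}, g x ∂μ) := by
  set S : ℕ → Set F := fun i => primePowBall F (n + i) \ primePowBall F (n + i + 1) with hS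
  have hSm : ∀ i, MeasurableSet (S i) := fun i => measurableSet_shell _
  have hSd : Pairwise (Function.onFun Disjoint S) := fun i j hij =>
    disjoint_shell (by omega)
  have hU : (⋃ i, S i) = primePowBall F n \ {0} := iUnion_shell n
  -- the real constants
  set q : ℝ := (residueFieldCard F : ℝ) with hq
  have hq1 : 1 < q := by rw [hq]; exact_mod_cast one_lt_residueFieldCard F
  have hq0 : 0 < q := zero_lt_one.trans hq1
  set μ0 : ℝ := μ.real (primePowBall F 0) with hμ0
  have hμ0pos : 0 < μ0 := measureReal_primePowBall_pos μ 0
  -- measure of a shell, as `ofReal`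
  have hμS : ∀ i : ℕ, μ (S i) ≤ ENNReal.ofReal ((q⁻¹) ^ (n + (i : ℤ)) * μ0) := by
    intro i
    calc μ (S i) ≤ μ (primePowBall F (n + i)) := measure_mono Set.sdiff_subset
      _ = ENNReal.ofReal (μ.real (primePowBall F (n + i))) :=
          (ENNReal.ofReal_toReal (measure_primePowBall_lt_top μ _).ne).symm
      _ = ENNReal.ofReal ((q⁻¹) ^ (n + (i : ℤ)) * μ0) := by rw [measureReal_primePowBall μ]
  -- integrability
  have hint : IntegrableOn g (primePowBall F n \ {0}) μ := by
    refine ⟨hg.restrict, ?_⟩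
    rw [hasFiniteIntegral_iff_enorm, ← hU, lintegral_iUnion hSm hSd]
    have hle : ∀ i, ∫⁻ x in S i, ‖g x‖ₑ ∂μ ≤
        ENNReal.ofReal (C * (q⁻¹) ^ n * μ0) * ENNReal.ofReal (θ * q⁻¹) ^ i := by
      intro i
      calc ∫⁻ x in S i, ‖g x‖ₑ ∂μ ≤ ∫⁻ _ in S i, ENNReal.ofReal (C * θ ^ i) ∂μ :=
            setLIntegral_mono' (hSm i) fun x hx => by
              rw [← ofReal_norm]
              exact ENNReal.ofReal_le_ofReal (hM i x hx)
        _ = ENNReal.ofReal (C * θ ^ i) * μ (S i) := setLIntegral_const _ _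
        _ ≤ ENNReal.ofReal (C * θ ^ i) * ENNReal.ofReal ((q⁻¹) ^ (n + (i : ℤ)) * μ0) := by
            gcongr
            exact hμS i
        _ = ENNReal.ofReal (C * (q⁻¹) ^ n * μ0) * ENNReal.ofReal (θ * q⁻¹) ^ i := by
            rw [← ENNReal.ofReal_pow (by positivity), ← ENNReal.ofReal_mul (by positivity),
              ← ENNReal.ofReal_mul (by positivity), zpow_add₀ (inv_ne_zero hq0.ne'), zpow_natCast,
              mul_pow]
            ring_nf
    refine lt_of_le_of_lt (ENNReal.tsum_le_tsum hle) ?_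
    rw [ENNReal.tsum_mul_left, ENNReal.tsum_geometric]
    refine ENNReal.mul_lt_top ENNReal.ofReal_lt_top (ENNReal.inv_lt_top.2 ?_)
    rw [tsub_pos_iff_lt, ENNReal.ofReal_lt_one]
    rw [← lt_div_iff₀ (inv_pos.2 hq0), div_inv_eq_mul, one_mul]
    exact hθ
  refine ⟨hint, ?_⟩
  have h := hasSum_integral_iUnion hSm hSd (hU ▸ hint)
  rwa [hU] at h

/-! ### The multiplicative Haar measure `d^×x = ‖x‖⁻¹ dx` on `Fˣ` -/

omit [ValuativeRel F] [TopologicalSpace F] [IsNonarchimedeanLocalField F] [MeasurableSpace F]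
  [BorelSpace F] in
/-- The range of `Units.val : Fˣ → F` is `{0}ᶜ`. [folklore] -/
theorem range_unitsVal : Set.range ((↑) : Fˣ → F) = {0}ᶜ := by
  ext x
  simp only [Set.mem_range, Set.mem_compl_iff, Set.mem_singleton_iff]
  exact ⟨fun ⟨u, hu⟩ => hu ▸ u.ne_zero, fun hx => ⟨Units.mk0 x hx, rfl⟩⟩

/-- `Units.val : Fˣ → F` is a measurable embedding (its `σ`-algebra is the pull-back). [folklore] -/
theorem measurableEmbedding_unitsVal : MeasurableEmbedding ((↑) : Fˣ → F) := by
  haveI : T2Space F := (GaloisRepresentations.IsNonarchimedeanLocalField.isLocalField F).toT2Space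
  rw [MeasurableEmbedding.iff_comap_eq]
  exact ⟨Units.val_injective, rfl, by rw [range_unitsVal]; exact (measurableSet_singleton 0).compl⟩

omit [MeasurableSpace F] [BorelSpace F] in
/-- `Units.val : Fˣ → F` is an open embedding. [folklore] -/
theorem isOpenEmbedding_unitsVal : IsOpenEmbedding ((↑) : Fˣ → F) := by
  haveI : T2Space F := (GaloisRepresentations.IsNonarchimedeanLocalField.isLocalField F).toT2Space
  exact ⟨Units.isEmbedding_val₀, by rw [range_unitsVal]; exact isOpen_compl_singleton⟩

/-- The density `‖x‖⁻¹` (as `ℝ≥0`, with `0⁻¹ = 0`) is measurable. [folklore] -/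
theorem measurable_inv_normAbs : Measurable fun x : F => (normAbs F x)⁻¹ :=
  measurable_normAbs.inv

/-- **Integration against `d^×x`**: for the pull-back `μ^×` of `‖·‖⁻¹ μ` to `Fˣ`,
`∫_{Fˣ} G(u) dμ^×(u) = ∫_F ‖x‖⁻¹ G(x) dμ(x)` (the point `0` is `μ`-null). [folklore] -/
theorem integral_unitsMeasure {E : Type*} [NormedAddCommGroup E] [NormedSpace ℝ E] (G : F → E) :
    ∫ u : Fˣ, G (u : F) ∂(Measure.comap ((↑) : Fˣ → F)
        (μ.withDensity fun x => (((normAbs F x)⁻¹ : ℝ≥0) : ℝ≥0∞))) =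
      ∫ x, ((normAbs F x)⁻¹ : ℝ) • G x ∂μ := by
  set ν : Measure F := μ.withDensity fun x => (((normAbs F x)⁻¹ : ℝ≥0) : ℝ≥0∞) with hν
  have hme := measurableEmbedding_unitsVal (F := F)
  have h0 : ν {0} = 0 := withDensity_absolutelyContinuous μ _ (measure_singleton_zero μ)
  calc ∫ u : Fˣ, G (u : F) ∂(Measure.comap ((↑) : Fˣ → F) ν)
        = ∫ x, G x ∂((Measure.comap ((↑) : Fˣ → F) ν).map ((↑) : Fˣ → F)) :=
          (hme.integral_map G).symm
    _ = ∫ x, G x ∂ν := by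
          rw [hme.map_comap, range_unitsVal, Measure.restrict_eq_self_of_ae_mem]
          exact compl_mem_ae_iff.2 h0
    _ = ∫ x, ((normAbs F x)⁻¹ : ℝ) • G x ∂μ := by
          rw [hν, integral_withDensity_eq_integral_smul measurable_inv_normAbs]
          rfl

/-- **Tate's zeta integral against `d^×x = ‖x‖⁻¹ dx` is an additive integral**:
`Z(f, χ, s) = ∫_F f(x) χ(x) ‖x‖^{s-1} dμ(x)`, where `χ` is extended by `0` to `F`. [folklore] -/
theorem tateZeta_unitsMeasure (f : F → ℂ) (χ : QuasiChar F) (s : ℂ) :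
    tateZeta (Measure.comap ((↑) : Fˣ → F)
        (μ.withDensity fun x => (((normAbs F x)⁻¹ : ℝ≥0) : ℝ≥0∞))) f χ s =
      ∫ x, f x * Function.extend ((↑) : Fˣ → F) (fun u => ((χ u : ℂˣ) : ℂ)) 0 x *
        (((normAbs F x : ℝ≥0) : ℝ) : ℂ) ^ (s - 1) ∂μ := by
  set χ' : F → ℂ := Function.extend ((↑) : Fˣ → F) (fun u => ((χ u : ℂˣ) : ℂ)) 0 with hχ'
  set G : F → ℂ := fun x => f x * χ' x * (((normAbs F x : ℝ≥0) : ℝ) : ℂ) ^ s with hG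
  have hGu : (fun u : Fˣ => f (u : F) * ((χ u : ℂˣ) : ℂ) *
      (((normAbs F (u : F) : ℝ≥0) : ℝ) : ℂ) ^ s) = fun u : Fˣ => G (u : F) := by
    funext u
    simp only [hG, hχ', Units.val_injective.extend_apply]
  rw [tateZeta, hGu, integral_unitsMeasure]
  refine integral_congr_ae (Filter.Eventually.of_forall fun x => ?_)
  by_cases hx : x = 0
  · subst hx
    have : χ' 0 = 0 := by
      rw [hχ', Function.extend_apply' _ _ _ (fun ⟨u, hu⟩ => u.ne_zero hu)]
      rfl
    simp [hG, this]
  · have hr : (((normAbs F x : ℝ≥0) : ℝ) : ℂ) ≠ 0 := by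
      exact_mod_cast (map_ne_zero (normAbs F)).2 hx
    show ((((normAbs F x : ℝ≥0) : ℝ))⁻¹) • G x =
      f x * χ' x * (((normAbs F x : ℝ≥0) : ℝ) : ℂ) ^ (s - 1)
    rw [Complex.real_smul, hG, Complex.cpow_sub _ _ hr, Complex.cpow_one]
    simp only
    push_cast
    field_simp

/-- **`d^×x = ‖x‖⁻¹ dx` is a Haar measure on `Fˣ`** (left invariant by `d(ax) = ‖a‖ dx`; finite
on compacts and positive on opens since `‖·‖⁻¹` is continuous and positive on `F ∖ {0}`)
(Tate 1950, §2.2–2.3; Weil 1967, Ch. II §1). [folklore] -/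
theorem isHaarMeasure_unitsMeasure :
    (Measure.comap ((↑) : Fˣ → F)
      (μ.withDensity fun x => (((normAbs F x)⁻¹ : ℝ≥0) : ℝ≥0∞))).IsHaarMeasure := by
  haveI : T2Space F := (GaloisRepresentations.IsNonarchimedeanLocalField.isLocalField F).toT2Space
  haveI : BorelSpace Fˣ := Units.borelSpace
  set d : F → ℝ≥0∞ := fun x => (((normAbs F x)⁻¹ : ℝ≥0) : ℝ≥0∞) with hd
  have hdm : Measurable d := measurable_inv_normAbs.coe_nnreal_ennreal
  set ν : Measure F := μ.withDensity d with hν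
  have hme := measurableEmbedding_unitsVal (F := F)
  have happ : ∀ T : Set Fˣ, Measure.comap ((↑) : Fˣ → F) ν T = ν (((↑) : Fˣ → F) '' T) :=
    fun T => hme.comap_apply ν T
  -- left invariance
  have hinv : ∀ (u : Fˣ) (T : Set Fˣ), MeasurableSet T →
      Measure.comap ((↑) : Fˣ → F) ν ((fun w => u * w) ⁻¹' T) = Measure.comap ((↑) : Fˣ → F) ν T := by
    intro u T hT
    set A : Set F := ((↑) : Fˣ → F) '' T with hA
    have hAm : MeasurableSet A := hme.measurableSet_image.2 hT
    have himg : ((↑) : Fˣ → F) '' ((fun w => u * w) ⁻¹' T) = (fun x => (u : F) * x) ⁻¹' A := by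
      ext x
      simp only [hA, Set.mem_image, Set.mem_preimage]
      constructor
      · rintro ⟨w, hw, rfl⟩
        exact ⟨u * w, hw, by simp⟩
      · rintro ⟨w', hw', hx⟩
        refine ⟨u⁻¹ * w', by simpa using hw', ?_⟩
        simp only [Units.val_mul, hx, Units.inv_mul_cancel_left]
    rw [happ, happ, himg]
    have ha : (u : F) ≠ 0 := u.ne_zero
    have hpre : MeasurableSet ((fun x => (u : F) * x) ⁻¹' A) := measurable_const_mul _ hAm
    -- `ν((u ·)⁻¹ A) = ν(A)` by the scaling `∫⁻ h(a x) = ‖a‖⁻¹ ∫⁻ h`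
    have key := lintegral_comp_mul_left μ (A.indicator d) ha
    have hcomp : (fun x => A.indicator d ((u : F) * x)) =
        fun x => ((normAbs F (u : F))⁻¹ : ℝ≥0) * ((fun x => (u : F) * x) ⁻¹' A).indicator d x := by
      funext x
      by_cases hx : (u : F) * x ∈ A
      · rw [Set.indicator_of_mem hx, Set.indicator_of_mem (show x ∈ (fun x => (u : F) * x) ⁻¹' A from hx)]
        simp only [hd, map_mul, mul_inv, ENNReal.coe_mul]
      · rw [Set.indicator_of_notMem hx,
          Set.indicator_of_notMem (show x ∉ (fun x => (u : F) * x) ⁻¹' A from hx), mul_zero]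
    rw [hcomp, lintegral_const_mul _ (hdm.indicator hpre), lintegral_indicator hpre,
      lintegral_indicator hAm] at key
    have hc0 : (((normAbs F (u : F))⁻¹ : ℝ≥0) : ℝ≥0∞) ≠ 0 := by
      simp [(map_ne_zero (normAbs F)).2 ha]
    rw [hν, withDensity_apply _ hpre, withDensity_apply _ hAm]
    exact (ENNReal.mul_right_inj hc0 ENNReal.coe_ne_top).1 key
  refine
    { toIsMulLeftInvariant := ⟨fun u => Measure.ext fun T hT => ?_⟩
      lt_top_of_isCompact := fun K hK => ?_
      open_pos := fun U hU hne => ?_ }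
  · -- finite on compacts
    rw [happ]
    set K' : Set F := ((↑) : Fˣ → F) '' K with hK'
    have hK'c : IsCompact K' := hK.image Units.continuous_val
    have hK'0 : ∀ x ∈ K', x ≠ 0 := by
      rintro _ ⟨u, -, rfl⟩
      exact u.ne_zero
    rcases K'.eq_empty_or_nonempty with hKe | hKne
    · rw [hKe, measure_empty]
      exact ENNReal.zero_lt_top
    obtain ⟨x₀, hx₀, hmin⟩ := hK'c.exists_isMinOn hKne continuous_normAbs.continuousOn
    have hx₀0 : normAbs F x₀ ≠ 0 := (map_ne_zero _).2 (hK'0 x₀ hx₀)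
    have hbound : ∀ x ∈ K', d x ≤ (((normAbs F x₀)⁻¹ : ℝ≥0) : ℝ≥0∞) := by
      intro x hx
      simp only [hd, ENNReal.coe_le_coe]
      exact inv_anti₀ (pos_iff_ne_zero.2 hx₀0) (hmin hx)
    rw [hν, withDensity_apply _ hK'c.measurableSet]
    calc ∫⁻ x in K', d x ∂μ ≤ ∫⁻ _ in K', (((normAbs F x₀)⁻¹ : ℝ≥0) : ℝ≥0∞) ∂μ :=
          setLIntegral_mono' hK'c.measurableSet hbound
      _ = _ * μ K' := setLIntegral_const _ _
      _ < ∞ := ENNReal.mul_lt_top ENNReal.coe_lt_top hK'c.measure_lt_top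
  · rw [Measure.map_apply (measurable_const_mul u) hT]
    exact hinv u T hT
  · -- positive on non-empty opens
    rw [happ]
    have hUo : IsOpen (((↑) : Fˣ → F) '' U) := isOpenEmbedding_unitsVal.isOpenMap _ hU
    have hUne : (((↑) : Fˣ → F) '' U).Nonempty := hne.image _
    rw [hν, Ne, withDensity_apply_eq_zero hdm]
    have hsub : {x | d x ≠ 0} ∩ ((↑) : Fˣ → F) '' U = ((↑) : Fˣ → F) '' U := by
      refine Set.inter_eq_right.2 ?_
      rintro _ ⟨u, -, rfl⟩
      simp [hd]
    rw [hsub]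
    exact (hUo.measure_pos μ hUne).ne'

end Measure

end LocalFieldHaar

end Literature.NumberTheory.Automorphic
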